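import Literature.MathematicalPhysics.QuantumManyBody.PeriodicSlotDepletion
import Summits.AtomisticToContinuum.BoseEinsteinCondensation.Theorems.BECDispersionLadderEndpointTransferOccupationFourier

/-!
# The depletion dictionary `N - ⟨Ψ, n̂₀Ψ⟩ = dep(ιΨ)` and the rewarded energy of trial states
# (crux `RewardChordBound`, stmt-AtomisticToContinuum-12876, stubs 4a/4b, helper file)

For a periodic `C¹` Bose trial state `Ψ` on the torus `(ℝ³/Lℤ³)^N`, the number of particles outside the
condensate, `N - condensateOccupation N L Ψ.ψ`, is the zero-mode DEPLETION
`depletion N (ιΨ) = ∑ᵢ ‖(1 - Pᵢ) ιΨ‖²` (`Literature/…/PeriodicSlotDepletion.lean`) of the embedded class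
`ιΨ ∈ L²((ℝ/ℤ)^{3N})` of the max-form package (`natCast_sub_condensateOccupation_eq_ofReal_depletion`): the
Bose-symmetric Fourier bookkeeping `∑_p w(p) n_Ψ(p) = ∑_ν (∑ᵢ w(νᵢ)) |⟪e_ν, ιΨ⟫|²` of
`…EndpointTransferOccupationFourier` with the weight `w = 𝟙[p ≠ 0]`, and `∑_p n_Ψ(p) = N`. Consequently the
rewarded energy `rewardedEnergy hL hv hW s Ψ = periodicEnergy v Ψ + s·dep(ιΨ)` of the Literature package IS the
crux's rewarded functional `F_s(Ψ) = ⟨Ψ, HΨ⟩ + s(N - ⟨Ψ, n̂₀Ψ⟩)` (`rewardedEnergy_eq`), and its infimum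
`rewardedGroundStateEnergy hL hv hW s` is the crux's reward infimum `R(s)` (`rewardedGroundStateEnergy_eq_iInf`).
All `[folklore]`; no definitions.
-/

noncomputable section

open MeasureTheory Filter UnitAddTorus Complex
open scoped ENNReal NNReal Topology InnerProductSpace ComplexConjugate

namespace Summit.AtomisticToContinuum.BoseEinsteinCondensation.Cruxes.RewardChordBound.Birth.DepletionDictionary

open Literature.MathematicalPhysics.QuantumManyBody.BoseGas Literature.Analysis.FunctionSpaces
open Summit.AtomisticToContinuum.BoseEinsteinCondensation.Theorems
open Summit.AtomisticToContinuum.BoseEinsteinCondensation.Cruxes.StaticResponseBound.UvThomsonForceWave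

-- The measure on `ℝ/ℤ` is the Haar PROBABILITY measure, as in `PeriodicFormDomain.lean`.
attribute [local instance] Literature.MathematicalPhysics.QuantumManyBody.BoseGas.formDomain_measureSpace
  Literature.MathematicalPhysics.QuantumManyBody.BoseGas.formDomain_isProbabilityMeasure
  Literature.MathematicalPhysics.QuantumManyBody.BoseGas.formDomain_isProbabilityMeasure_pi

variable {N : ℕ} {L : ℝ} {v : ℝ → ℝ≥0∞}

/-- **The depletion as a spectral weight sum**: `dep η = ∑ₙ (∑ᵢ 𝟙[n_{(i,·)} ≠ 0]) |⟪eₙ, η⟫|²` in `ℝ≥0∞`.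
[folklore] -/
theorem ofReal_depletion_eq_tsum (η : Lp ℂ 2 (volume : Measure (UnitAddTorus (Fin N × Fin 3)))) :
    ENNReal.ofReal (depletion N η) = ∑' n : Fin N × Fin 3 → ℤ,
      (∑ i : Fin N, (if (fun k => n (i, k)) = 0 then (0 : ℝ≥0∞) else 1)) *
        ((‖⟪(mFourierLp 2 n : Lp ℂ 2 (volume : Measure (UnitAddTorus (Fin N × Fin 3)))), η⟫_ℂ‖₊ : ℝ≥0∞)) ^ 2 := by
  rw [depletion, ENNReal.ofReal_sum_of_nonneg (fun i _ => sq_nonneg _)]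
  simp_rw [ofReal_norm_exciteProj_sq]
  rw [← Summable.tsum_finsetSum (fun _ _ => ENNReal.summable)]
  refine tsum_congr fun n => ?_
  rw [Finset.sum_mul]
  refine Finset.sum_congr rfl fun i _ => ?_
  split_ifs
  · rw [zero_mul]
  · rw [one_mul, HaarTorus.inner_mFourierLp_eq_mFourierCoeff, enorm_eq_nnnorm]

/-- **The depletion dictionary**: for a periodic trial state `Ψ`,
`N - condensateOccupation N L Ψ.ψ = dep(ι(graphEmbed Ψ))` (any admissible auxiliary embedding `(v, hv, hW)`):
`N - n₀ = ∑_{p ≠ 0} n_Ψ(p)` (`∑_p n_Ψ(p) = N`) and the Bose-symmetric Fourier bookkeeping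
`∑_p 𝟙[p ≠ 0] n_Ψ(p) = ∑_ν (∑ᵢ 𝟙[νᵢ ≠ 0]) |⟪e_ν, ιΨ⟫|²`. [folklore] -/
theorem natCast_sub_condensateOccupation_eq_ofReal_depletion (hL : 0 < L) (hv : Measurable v)
    (hW : ∫⁻ X in cellN N L, periodicInteraction v L X ≠ ⊤) (Ψ : PeriodicTrialState N L) :
    (N : ℝ≥0∞) - condensateOccupation N L Ψ.ψ =
      ENNReal.ofReal (depletion N (formEmbed hL hv hW
        ⟨graphEmbed hL hv hW ⟨Ψ.ψ, Ψ.mem_periodicCore⟩, graphEmbed_mem_formDomain hL hv hW _⟩)) := by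
  classical
  have h1 := Ψ.tsum_cellOccupation_planeWaveMode hL
  rw [ENNReal.tsum_eq_add_tsum_ite (0 : Fin 3 → ℤ), cellOccupation_planeWaveMode_zero] at h1
  have hfin : condensateOccupation N L Ψ.ψ ≠ ⊤ := by
    intro htop
    rw [htop, top_add] at h1
    exact ENNReal.natCast_ne_top N h1.symm
  have h2 : (N : ℝ≥0∞) - condensateOccupation N L Ψ.ψ =
      ∑' p : Fin 3 → ℤ, (if p = 0 then (0 : ℝ≥0∞) else 1) * cellOccupation N L (planeWaveMode L p) Ψ.ψ := by
    rw [← h1, ENNReal.add_sub_cancel_left hfin]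
    refine tsum_congr fun p => ?_
    split_ifs
    · rw [zero_mul]
    · rw [one_mul]
  rw [h2, EndpointTransfer.tsum_mul_cellOccupation_eq_tsum_inner hL Ψ (fun p => if p = 0 then (0 : ℝ≥0∞) else 1),
    ofReal_depletion_eq_tsum]
  refine tsum_congr fun n => ?_
  rw [inner_mFourierLp_formEmbed_trialState hL Ψ n,
    inner_mFourierLp_formEmbed_graphEmbed hL hv hW ⟨Ψ.ψ, Ψ.mem_periodicCore⟩ n]

/-- **The rewarded energy of the Literature package is the crux's rewarded functional**:
`rewardedEnergy hL hv hW s Ψ = periodicEnergy v Ψ + s (N - condensateOccupation N L Ψ.ψ)` (`s ≥ 0`). [folklore] -/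
theorem rewardedEnergy_eq (hL : 0 < L) (hv : Measurable v) (hW : ∫⁻ X in cellN N L, periodicInteraction v L X ≠ ⊤)
    {s : ℝ} (hs : 0 ≤ s) (Ψ : PeriodicTrialState N L) :
    rewardedEnergy hL hv hW s Ψ =
      periodicEnergy v Ψ + ENNReal.ofReal s * ((N : ℝ≥0∞) - condensateOccupation N L Ψ.ψ) := by
  rw [rewardedEnergy_def, ENNReal.ofReal_mul hs, natCast_sub_condensateOccupation_eq_ofReal_depletion hL hv hW Ψ]

/-- **The rewarded ground-state energy of the Literature package is the crux's reward infimum `R(s)`.**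
[folklore] -/
theorem rewardedGroundStateEnergy_eq_iInf (hL : 0 < L) (hv : Measurable v)
    (hW : ∫⁻ X in cellN N L, periodicInteraction v L X ≠ ⊤) {s : ℝ} (hs : 0 ≤ s) :
    rewardedGroundStateEnergy hL hv hW s = ⨅ Ψ : PeriodicTrialState N L,
      (periodicEnergy v Ψ + ENNReal.ofReal s * ((N : ℝ≥0∞) - condensateOccupation N L Ψ.ψ)) := by
  unfold rewardedGroundStateEnergy
  exact iInf_congr fun Ψ => rewardedEnergy_eq hL hv hW hs Ψ

end Summit.AtomisticToContinuum.BoseEinsteinCondensation.Cruxes.RewardChordBound.Birth.DepletionDictionary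

namespace Summit.AtomisticToContinuum.BoseEinsteinCondensation.Cruxes.RewardChordBound.Birth

open Summit.AtomisticToContinuum.BoseEinsteinCondensation.Cruxes.RewardChordBound.Birth.DepletionDictionary

/-- **Registered sub-goal of stub `stub_rewardedZeroMomentumIntegrable` (helper file): the depletion
dictionary** — the rewarded ground-state energy of the Literature max-form package (`rewardedEnergy = E + s·dep(ιΨ)`)
is the crux's reward infimum `R(s) = inf_Ψ (E(Ψ) + s(N - ⟨Ψ, n̂₀Ψ⟩))`. [folklore] -/
theorem stub_rewardedZeroMomentumIntegrable_DepletionDictionary :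
    ∀ (N : ℕ) (L : ℝ) (v : ℝ → ENNReal) (hL : 0 < L) (hv : Measurable v) (hW : (∫⁻ X in Literature.MathematicalPhysics.QuantumManyBody.BoseGas.cellN N L, Literature.MathematicalPhysics.QuantumManyBody.BoseGas.periodicInteraction v L X) ≠ ⊤) (s : ℝ), 0 ≤ s → Literature.MathematicalPhysics.QuantumManyBody.BoseGas.rewardedGroundStateEnergy hL hv hW s = ⨅ Ψ : Literature.MathematicalPhysics.QuantumManyBody.BoseGas.PeriodicTrialState N L, (Literature.MathematicalPhysics.QuantumManyBody.BoseGas.periodicEnergy v Ψ + ENNReal.ofReal s * ((N : ENNReal) - Literature.MathematicalPhysics.QuantumManyBody.BoseGas.condensateOccupation N L Ψ.ψ)) :=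
  fun _ _ _ hL hv hW _ hs => rewardedGroundStateEnergy_eq_iInf hL hv hW hs

end Summit.AtomisticToContinuum.BoseEinsteinCondensation.Cruxes.RewardChordBound.Birth

end
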